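import Summits.HubbardSuperconductivity.HubbardSuperconductivity.Theorems.LevyLogBootstrapHalfFilledOrderChemPotRP
import Summits.HubbardSuperconductivity.HubbardSuperconductivity.Theorems.AnisotropyChordSectorAnchorXYHalfFilled
import Summits.HubbardSuperconductivity.HubbardSuperconductivity.Theorems.PolyaSchurPairBosonSectorPerronXXZ

/-!
# Route `LevyLogBootstrap`, hub `HalfFilledOrder` (stmt-HubbardSuperconductivity-0906) — window, part 2:
# every ground state of the easy-plane spin-½ XXZ torus is half filled

**Theorem** (`groundSpace_xxzTorus_le_spinZSector_zero`). For `d ≥ 1`, even `L ≥ 4` and every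
anisotropy `Δ ≤ 0`, every ground vector of the spin-½ ferro-XY / AF-Ising torus model
`H(Δ) = xxzHamiltonian 1 (torusGraph d L) (-1) Δ = -Σ_{⟨xy⟩}(SˣSˣ + SʸSʸ + Δ SᶻSᶻ)` (hard-core bosons
with nearest-neighbour repulsion `-Δ`) lies in the sector `S³_tot = 0` (half filling); with the
sector Perron–Frobenius theorem (`xxz_sector_perronFrobenius`) the ground state is therefore unique.
The case `Δ = 0` is `AnisotropyChord.groundSpace_xyTorus_le_spinZSector_zero` (part 3 of
`SectorAnchorXY`); this file does `Δ < 0` by the same argument and packages both.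

Proof (`Δ < 0`). Let `E₀` be the ground energy, `F(μ) = E₀(H - μS³_tot) = min_M (E(M) - μM)` and
`X = S³_{Λ_L} - S³_{Λ_R}` the magnetisation imbalance across a pair of reflection planes.
(1) Reflection positivity with a chemical potential (part 1, `xxz_groundEnergy_chemPot_reflect_le`):
`F(μ) ≥ ½E₀(H - μX) + ½E₀(H + μX)`. (2) `X` is blind on the ground space: the ground space splits
into its sector components, each a sector ground space, one-dimensional by Perron–Frobenius
(`xxz_sector_perronFrobenius`, any `Δ`) and spanned by a nonnegative vector `ψ`; the reflection `θ`
is a symmetry of `H(Δ)` preserving sectors (`xxzTorus_submatrix_comp_reflect`), so `ψ ∘ θ = ψ`,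
while `X ∘ θ = -X`, whence `⟨ψ, Xψ⟩ = 0`. (3) Second-order perturbation theory
(`AnisotropyChord.le_groundEnergy_sub_smul_diagonal`): `E₀(H ∓ μX) ≥ E₀ - Cμ²`, so
`F(μ) ≥ E₀ - Cμ²`. (4) A ground vector in a sector `M ≠ 0` would give `F(μ) ≤ E₀ - μM`, a kink of
`F` at `μ = 0` — contradiction. Aizenman–Lieb–Seiringer–Solovej–Yngvason, PRA 70 (2004) 023612,
App. A (there for `Δ = 0`; the argument uses only reflection positivity, available on the whole
antiferromagnetic side `Δ ≤ 0` after the Kennedy–Lieb–Shastry sublattice rotation);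
Lieb–Seiringer–Solovej–Yngvason, *The Mathematics of the Bose Gas* (2005), Ch. 11. No definition is
introduced.
-/

-- the mandated namespace `Summit.<Summit>.<Problem>.Theorems` repeats `HubbardSuperconductivity`
set_option linter.dupNamespace false

noncomputable section

namespace Summit.HubbardSuperconductivity.HubbardSuperconductivity.Theorems.LevyLogBootstrap

open Matrix Finset Literature.MathematicalPhysics.QuantumLattice Literature.Probability.LatticeModels
open Summit.HubbardSuperconductivity.HubbardSuperconductivity.Theorems.AnisotropyChord
  (mag_one_eq lowestEnergyInSector_eq_groundEnergy le_groundEnergy_sub_smul_diagonal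
    sum_compl_torusLeftHalf groundSpace_xyTorus_le_spinZSector_zero)
open Summit.HubbardSuperconductivity.HubbardSuperconductivity.Theorems.PolyaSchurPairBoson
  (xxz_sector_perronFrobenius)
open Summit.AtomisticToContinuum.BoseEinsteinCondensation.Theorems.BECStronglyRayleighSectorPerron
  (torusGraph_connected)
open scoped ComplexOrder

variable {d : ℕ}

/-! ### The reflection is a symmetry of the XXZ torus -/

/-- **The XXZ Hamiltonian of the torus is invariant under the reflection between sites**
(a graph automorphism of the torus, `torusGraph_adj_reflectBetweenSites`; on tensor indices
`σ ↦ σ ∘ θ`). [folklore] -/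
theorem xxzTorus_submatrix_comp_reflect (L : ℕ) [NeZero L] (n : ℕ) (J Δ : ℝ) (j : Fin d)
    (a : ZMod L) :
    (xxzHamiltonian n (torusGraph d L) J Δ).submatrix
        (fun σ : TensorIndex (TorusSite d L) (n + 1) => σ ∘ Torus.reflectBetweenSites j a)
        (fun σ => σ ∘ Torus.reflectBetweenSites j a) = xxzHamiltonian n (torusGraph d L) J Δ := by
  set π : TorusSite d L ≃ TorusSite d L := Torus.reflectBetweenSites j a with hπ
  simp only [xxzHamiltonian, submatrix_smul, Pi.smul_apply, submatrix_finset_sum]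
  congr 1
  refine Finset.sum_nbij' (Sym2.map π) (Sym2.map π) (fun e he => ?_) (fun e he => ?_)
    (fun e _ => ?_) (fun e _ => ?_) (fun e _ => ?_)
  · exact (map_reflectBetweenSites_mem_edgeFinset L j a).2 he
  · exact (map_reflectBetweenSites_mem_edgeFinset L j a).2 he
  · exact map_reflectBetweenSites_map_reflectBetweenSites L j a e
  · exact map_reflectBetweenSites_map_reflectBetweenSites L j a e
  · induction e using Sym2.ind with
    | h x y =>
      simp only [Sym2.map_mk, Sym2.lift_mk, submatrix_add, submatrix_smul, Pi.add_apply,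
        Pi.smul_apply, spinBond_submatrix_comp]

/-! ### The theorem for `Δ < 0` -/

/-- **Every ground state of the spin-½ XXZ torus with `Δ < 0` is half filled.** For `d ≥ 1` and
even `L ≥ 4` (`Even L`, `3 ≤ L`), the ground space of `xxzHamiltonian 1 (torusGraph d L) (-1) Δ`,
`Δ < 0`, is contained in the sector `S³_tot = 0`. Reflection positivity with a chemical potential
(`xxz_groundEnergy_chemPot_reflect_le`), blindness of the magnetisation imbalance on the
(sector-wise Perron–Frobenius, reflection-symmetric) ground space, second-order perturbation theory
and the kink argument (module docstring). Aizenman–Lieb–Seiringer–Solovej–Yngvason (2004), App. A.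
[folklore] -/
theorem groundSpace_xxzTorus_le_spinZSector_zero_of_neg (hd : 1 ≤ d) (L : ℕ) [NeZero L]
    (hL : Even L) (hL3 : 3 ≤ L) {Δ : ℝ} (hΔ : Δ < 0) :
    (xxzHamiltonian 1 (torusGraph d L) (-1) Δ).groundSpace ≤ spinZSector 1 0 := by
  classical
  -- the planes
  set j : Fin d := ⟨0, hd⟩ with hj
  set a : ZMod L := 0 with ha
  set θ := Torus.reflectBetweenSites (d := d) (L := L) j a with hθ
  set Λl := torusLeftHalf L j a with hΛl
  set H : Op (TorusSite d L) 2 := xxzHamiltonian 1 (torusGraph d L) (-1) Δ with hHdef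
  have hH : H.IsHermitian := xxzHamiltonian_isHermitian 1 _ (-1) Δ
  set E := H.groundEnergy with hE
  have hcard : Fintype.card (TorusSite d L) = L ^ d := by
    show Fintype.card (Fin d → ZMod L) = L ^ d
    rw [Fintype.card_fun, ZMod.card, Fintype.card_fin]
  haveI : Nonempty (TensorIndex (TorusSite d L) 2) := ⟨fun _ => 0⟩
  -- weights and the sector labels
  let wt : TensorIndex (TorusSite d L) 2 → ℕ := fun σ => ∑ z, (σ z : ℕ)
  have hwt_le : ∀ σ, wt σ ≤ L ^ d := by
    intro σ
    calc wt σ ≤ ∑ _z : TorusSite d L, 1 := sum_le_sum fun z _ => Nat.lt_succ_iff.mp (σ z).2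
      _ = L ^ d := by rw [sum_const, card_univ, smul_eq_mul, mul_one, hcard]
  have hwt_def : ∀ σ, wt σ = ∑ z, (σ z : ℕ) := fun σ => rfl
  let lab : ℕ → ℝ := fun w => ((Fintype.card (TorusSite d L) * 1 : ℕ) : ℝ) / 2 - (w : ℝ)
  have hlab : ∀ w : ℕ, lab w = ((Fintype.card (TorusSite d L) * 1 : ℕ) : ℝ) / 2 - (w : ℝ) :=
    fun w => rfl
  have hmag : ∀ σ, mag 1 σ = lab (wt σ) := by
    intro σ
    rw [hlab, mul_one, mag_one_eq]
  -- (0) entries: `H` preserves the weight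
  have hwt : ∀ σ τ : TensorIndex (TorusSite d L) 2, wt σ ≠ wt τ → H σ τ = 0 := by
    have hent := Summit.AtomisticToContinuum.BoseEinsteinCondensation.Cruxes.GroundStateStability.StableConeVariationalSelection.leadPF_entries
      (torusGraph d L) Δ (fun _ => (0 : ℝ))
    simp only [Complex.ofReal_zero, zero_smul, Finset.sum_const_zero, add_zero] at hent
    exact hent.2.2.2.2
  -- sector truncation of a vector
  let trunc : ℕ → (TensorIndex (TorusSite d L) 2 → ℂ) → (TensorIndex (TorusSite d L) 2 → ℂ) :=
    fun w v σ => if wt σ = w then v σ else 0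
  have htrunc_apply : ∀ w v σ, trunc w v σ = if wt σ = w then v σ else 0 := fun _ _ _ => rfl
  have htrunc_mem : ∀ w, ∀ v ∈ H.groundSpace, trunc w v ∈ H.groundSpace := by
    intro w v hv
    rw [mem_groundSpace_iff] at hv ⊢
    funext σ
    rw [Pi.smul_apply, smul_eq_mul, htrunc_apply, mulVec, dotProduct]
    by_cases hσ : wt σ = w
    · rw [if_pos hσ]
      have h := congrFun hv σ
      rw [Pi.smul_apply, smul_eq_mul, mulVec, dotProduct] at h
      rw [← h]
      refine sum_congr rfl fun τ _ => ?_
      rw [htrunc_apply]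
      by_cases hτ : wt τ = w
      · rw [if_pos hτ]
      · rw [if_neg hτ, mul_zero, hwt σ τ (by rw [hσ]; exact Ne.symm hτ), zero_mul]
    · rw [if_neg hσ, mul_zero]
      refine sum_eq_zero fun τ _ => ?_
      rw [htrunc_apply]
      by_cases hτ : wt τ = w
      · rw [hwt σ τ (by rw [hτ]; exact hσ), zero_mul]
      · rw [if_neg hτ, mul_zero]
  have htrunc_sector : ∀ w v, trunc w v ∈ spinZSector (Λ := TorusSite d L) 1 (lab w) := by
    intro w v
    rw [mem_spinZSector_iff]
    intro σ hσ
    rw [htrunc_apply, if_neg]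
    intro hw
    apply hσ
    rw [hmag σ, hw]
  have htrunc_ne : ∀ w v, trunc w v ≠ 0 → ∃ σ : TensorIndex (TorusSite d L) 2, wt σ = w := by
    intro w v h0
    obtain ⟨σ, hσ⟩ := Function.ne_iff.mp h0
    refine ⟨σ, ?_⟩
    by_contra hw
    rw [htrunc_apply, if_neg hw] at hσ
    exact hσ rfl
  -- (1) the imbalance observable, as a real diagonal matrix
  let xf : TensorIndex (TorusSite d L) 2 → ℝ := fun σ =>
    ∑ x ∈ Λl, ((1 : ℝ) / 2 - ((σ x : ℕ) : ℝ)) - ∑ x ∈ Λlᶜ, ((1 : ℝ) / 2 - ((σ x : ℕ) : ℝ))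
  have hxf_def : ∀ σ, xf σ =
      ∑ x ∈ Λl, ((1 : ℝ) / 2 - ((σ x : ℕ) : ℝ)) - ∑ x ∈ Λlᶜ, ((1 : ℝ) / 2 - ((σ x : ℕ) : ℝ)) :=
    fun σ => rfl
  set D : Op (TorusSite d L) 2 := diagonal fun σ => ((xf σ : ℝ) : ℂ) with hD
  have hXD : (∑ x ∈ Λl, siteSpin 1 x 2 - ∑ x ∈ Λlᶜ, siteSpin 1 x 2 : Op (TorusSite d L) 2) = D := by
    ext σ τ
    rw [hD, diagonal_apply, Matrix.sub_apply, Matrix.sum_apply, Matrix.sum_apply]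
    simp only [siteSpin_two_apply, Nat.cast_one]
    by_cases hστ : σ = τ
    · simp only [if_pos hστ]
      rw [hxf_def]
      push_cast
      ring
    · simp only [if_neg hστ, sum_const_zero, sub_zero]
  have hxB : ∀ σ, |xf σ| ≤ (Fintype.card (TorusSite d L) : ℝ) := by
    intro σ
    have hterm : ∀ x, |(1 : ℝ) / 2 - ((σ x : ℕ) : ℝ)| ≤ 1 := by
      intro x
      have h2 : ((σ x : ℕ) : ℝ) ≤ 1 := by exact_mod_cast Nat.lt_succ_iff.mp (σ x).2
      have h0 : (0 : ℝ) ≤ ((σ x : ℕ) : ℝ) := by positivity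
      rw [abs_le]; constructor <;> linarith
    have hs : ∀ s : Finset (TorusSite d L),
        |∑ x ∈ s, ((1 : ℝ) / 2 - ((σ x : ℕ) : ℝ))| ≤ s.card := fun s =>
      calc |∑ x ∈ s, ((1 : ℝ) / 2 - ((σ x : ℕ) : ℝ))| ≤ ∑ x ∈ s, |(1 : ℝ) / 2 - ((σ x : ℕ) : ℝ)| :=
            abs_sum_le_sum_abs _ _
        _ ≤ ∑ _x ∈ s, (1 : ℝ) := sum_le_sum fun x _ => hterm x
        _ = s.card := by rw [sum_const, nsmul_eq_mul, mul_one]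
    calc |xf σ| ≤ |∑ x ∈ Λl, ((1 : ℝ) / 2 - ((σ x : ℕ) : ℝ))| +
          |∑ x ∈ Λlᶜ, ((1 : ℝ) / 2 - ((σ x : ℕ) : ℝ))| := abs_sub _ _
      _ ≤ (Λl.card : ℝ) + (Λlᶜ.card : ℝ) := add_le_add (hs _) (hs _)
      _ = (Fintype.card (TorusSite d L) : ℝ) := by
          rw [← Nat.cast_add, Finset.card_add_card_compl]
  -- `xf ∘ θ = -xf`
  have hxθ : ∀ σ : TensorIndex (TorusSite d L) 2, xf (σ ∘ θ) = -xf σ := by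
    intro σ
    show (∑ x ∈ Λl, ((1 : ℝ) / 2 - (((σ ∘ θ) x : ℕ) : ℝ)) -
        ∑ x ∈ Λlᶜ, ((1 : ℝ) / 2 - (((σ ∘ θ) x : ℕ) : ℝ))) =
      -(∑ x ∈ Λl, ((1 : ℝ) / 2 - ((σ x : ℕ) : ℝ)) - ∑ x ∈ Λlᶜ, ((1 : ℝ) / 2 - ((σ x : ℕ) : ℝ)))
    rw [sum_compl_torusLeftHalf L j a hL (fun x => (1 : ℝ) / 2 - ((σ x : ℕ) : ℝ)),
      sum_compl_torusLeftHalf L j a hL (fun x => (1 : ℝ) / 2 - (((σ ∘ θ) x : ℕ) : ℝ))]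
    simp only [Function.comp_apply, hθ, reflectBetweenSites_reflectBetweenSites]
    ring
  -- (2) blindness of `D` on the ground space
  set θhat : TensorIndex (TorusSite d L) 2 ≃ TensorIndex (TorusSite d L) 2 :=
    Equiv.arrowCongr (Torus.reflectBetweenSites j a).symm (Equiv.refl (Fin 2)) with hθhat
  have hθhat_apply : ∀ σ, θhat σ = σ ∘ θ := fun σ => rfl
  have hinv : H.submatrix θhat θhat = H := xxzTorus_submatrix_comp_reflect L 1 (-1) Δ j a
  have hwtθ : ∀ σ, wt (σ ∘ θ) = wt σ := by
    intro σ
    show ∑ z, ((σ (θ z) : Fin 2) : ℕ) = ∑ z, ((σ z : Fin 2) : ℕ)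
    exact Fintype.sum_equiv θ _ _ fun z => rfl
  -- the quadratic form of `D`
  have hform : ∀ u : TensorIndex (TorusSite d L) 2 → ℂ,
      star u ⬝ᵥ D *ᵥ u = ∑ σ, ((xf σ : ℝ) : ℂ) * (star (u σ) * u σ) := by
    intro u
    simp only [hD, dotProduct, mulVec_diagonal, Pi.star_apply]
    exact sum_congr rfl fun σ _ => by ring
  -- the Perron vector of a sector is reflection invariant, hence `D`-blind
  have hblindψ : ∀ w : ℕ, ∀ ψ : TensorIndex (TorusSite d L) 2 → ℂ, ψ ≠ 0 →
      (∀ σ, 0 ≤ (ψ σ).re ∧ (ψ σ).im = 0) →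
      ψ ∈ spinZSector (Λ := TorusSite d L) 1 (lab w) →
      H *ᵥ ψ = ((lowestEnergyInSector 1 H (lab w) : ℝ) : ℂ) • ψ →
      (∀ ψ' : TensorIndex (TorusSite d L) 2 → ℂ,
        ψ' ∈ spinZSector (Λ := TorusSite d L) 1 (lab w) →
        H *ᵥ ψ' = ((lowestEnergyInSector 1 H (lab w) : ℝ) : ℂ) • ψ' →
        ∃ c : ℂ, ψ' = c • ψ) →
      star ψ ⬝ᵥ D *ᵥ ψ = 0 := by
    intro w ψ hψ0 hψnn hψK hHψ huniq
    set M : ℝ := lab w with hM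
    -- the reflected vector is a sector eigenvector with the same eigenvalue
    set ψθ : TensorIndex (TorusSite d L) 2 → ℂ := fun σ => ψ (σ ∘ θ) with hψθ
    have hψθK : ψθ ∈ spinZSector (Λ := TorusSite d L) 1 M := by
      rw [mem_spinZSector_iff] at hψK ⊢
      intro σ hσ
      apply hψK
      rwa [hmag, hwtθ, ← hmag]
    have hHψθ : H *ᵥ ψθ = ((lowestEnergyInSector 1 H M : ℝ) : ℂ) • ψθ := by
      have h1 : ψθ = ψ ∘ θhat := funext fun σ => by rw [Function.comp_apply, hθhat_apply]
      rw [h1, ← hinv, submatrix_mulVec_equiv, hinv, Function.comp_assoc, Equiv.self_comp_symm,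
        Function.comp_id, hHψ]
      rfl
    obtain ⟨c, hc⟩ := huniq ψθ hψθK hHψθ
    -- `c = 1` by comparing the (positive) sums of entries
    have hsumθ : ∑ σ, ψθ σ = ∑ σ, ψ σ := Fintype.sum_equiv θhat _ _ fun σ => rfl
    have hsum_pos : (0 : ℝ) < (∑ σ, ψ σ).re := by
      rw [Complex.re_sum]
      obtain ⟨σ₀, hσ₀⟩ := Function.ne_iff.mp hψ0
      refine sum_pos' (fun σ _ => (hψnn σ).1) ⟨σ₀, mem_univ _, ?_⟩
      rcases (hψnn σ₀).1.lt_or_eq with h | h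
      · exact h
      · exact absurd (Complex.ext (by rw [← h]; rfl) (by rw [(hψnn σ₀).2]; rfl)) hσ₀
    have hsum_ne : (∑ σ, ψ σ) ≠ 0 := fun h0 => by
      rw [h0, Complex.zero_re] at hsum_pos; exact lt_irrefl _ hsum_pos
    have hc1 : c = 1 := by
      have h := hsumθ
      rw [hc] at h
      simp only [Pi.smul_apply, smul_eq_mul, ← mul_sum] at h
      exact mul_left_eq_self₀.mp h |>.resolve_right hsum_ne
    rw [hc1, one_smul] at hc
    -- `T = -T`
    have hT : star ψ ⬝ᵥ D *ᵥ ψ = -(star ψ ⬝ᵥ D *ᵥ ψ) := by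
      rw [hform]
      conv_lhs => rw [← Fintype.sum_equiv θhat _ _ (fun σ => rfl)]
      rw [← sum_neg_distrib]
      refine sum_congr rfl fun σ _ => ?_
      have hψσ : ψ (θhat σ) = ψ σ := by
        have := congrFun hc σ
        rw [hψθ] at this
        rw [hθhat_apply]
        exact this
      rw [hψσ, hθhat_apply, hxθ, Complex.ofReal_neg]
      ring
    have h2 : (2 : ℂ) * (star ψ ⬝ᵥ D *ᵥ ψ) = 0 := by rw [two_mul]; nth_rewrite 2 [hT]; ring
    exact (mul_eq_zero.mp h2).resolve_left two_ne_zero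
  have horth : ∀ v ∈ H.groundSpace, star v ⬝ᵥ D *ᵥ v = 0 := by
    intro v hv
    -- split the quadratic form over the weight sectors
    have hsplit : star v ⬝ᵥ D *ᵥ v = ∑ w ∈ range (L ^ d + 1), star (trunc w v) ⬝ᵥ D *ᵥ trunc w v := by
      rw [hform, ← sum_fiberwise_of_maps_to (g := wt) (t := range (L ^ d + 1))
        (fun σ _ => mem_range.2 (Nat.lt_succ_of_le (hwt_le σ)))]
      refine sum_congr rfl fun w _ => ?_
      rw [hform, ← sum_filter_add_sum_filter_not univ (fun σ => wt σ = w)]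
      rw [show ∑ σ ∈ univ.filter (fun σ => ¬wt σ = w),
          ((xf σ : ℝ) : ℂ) * (star (trunc w v σ) * trunc w v σ) = 0 from
        sum_eq_zero fun σ hσ => by
          rw [htrunc_apply, if_neg (mem_filter.1 hσ).2, mul_zero, mul_zero], add_zero]
      refine sum_congr rfl fun σ hσ => ?_
      rw [htrunc_apply, if_pos (mem_filter.1 hσ).2]
    rw [hsplit]
    refine sum_eq_zero fun w hw => ?_
    set u := trunc w v with hu
    by_cases hu0 : u = 0
    · rw [hu0, mulVec_zero, dotProduct_zero]
    have huG : u ∈ H.groundSpace := htrunc_mem w v hv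
    have huK := htrunc_sector w v
    rw [← hu] at huK
    obtain ⟨⟨ψ, hψK, hψ0, hψnn, hHψ⟩, huniq⟩ :=
      xxz_sector_perronFrobenius (torusGraph d L) (torusGraph_connected d L) Δ w (htrunc_ne w v hu0)
    have hEsec : lowestEnergyInSector 1 H (lab w) = E :=
      lowestEnergyInSector_eq_groundEnergy hH hu0 huG huK
    have hHu : H *ᵥ u = ((lowestEnergyInSector 1 H (lab w) : ℝ) : ℂ) • u := by
      rw [hEsec]; exact (mem_groundSpace_iff H u).mp huG
    obtain ⟨c, hc⟩ := huniq ψ u hψK huK hHψ hHu hψ0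
    have hψblind := hblindψ w ψ hψ0 hψnn hψK hHψ
      (fun ψ' hψ'K hHψ' => huniq ψ ψ' hψK hψ'K hHψ hHψ' hψ0)
    rw [hc, mulVec_smul, star_smul, smul_dotProduct, dotProduct_smul, hψblind, smul_zero, smul_zero]
  -- (3) second order + reflection positivity: `E - C μ² ≤ F(μ)`
  obtain ⟨C, hC0, hC⟩ := le_groundEnergy_sub_smul_diagonal hH xf hxB horth
  have hF : ∀ μ : ℝ, E - C * μ ^ 2 ≤ (H - (μ : ℂ) • totalSpin 1 2).groundEnergy := by
    intro μ
    have hRP := xxz_groundEnergy_chemPot_reflect_le (d := d) L j a 1 hL hL3 hΔ μ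
    rw [hXD] at hRP
    have h1 := hC μ
    have h2 := hC (-μ)
    rw [Complex.ofReal_neg, neg_smul, sub_neg_eq_add, neg_sq] at h2
    change E - C * μ ^ 2 ≤ (H - (μ : ℂ) • D).groundEnergy at h1
    change E - C * μ ^ 2 ≤ (H + (μ : ℂ) • D).groundEnergy at h2
    change ((H - (μ : ℂ) • D).groundEnergy + (H + (μ : ℂ) • D).groundEnergy) / 2 ≤
      (H - (μ : ℂ) • totalSpin 1 2).groundEnergy at hRP
    linarith
  -- (4) the kink argument
  intro v hv
  rw [mem_spinZSector_iff]
  intro σ₀ hσ₀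
  set w := wt σ₀ with hw
  suffices hu : trunc w v = 0 by
    have := congrFun hu σ₀
    rwa [htrunc_apply, if_pos rfl] at this
  by_contra hu0
  set u := trunc w v with hu
  have huG : u ∈ H.groundSpace := htrunc_mem w v hv
  have huK := htrunc_sector w v
  rw [← hu, ← hmag σ₀] at huK
  set M := mag 1 σ₀ with hM
  -- `F(μ) ≤ E - μ M`
  have hS : (H - ((M / (C + 1) : ℝ) : ℂ) • totalSpin 1 2).IsHermitian :=
    hH.sub ((totalSpin_isHermitian 1 2).smul
      (by rw [isSelfAdjoint_iff, Complex.star_def, Complex.conj_ofReal]))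
  obtain ⟨c, hc0, hc1⟩ := exists_smul_unit hu0
  have hHu : H *ᵥ u = (E : ℂ) • u := (mem_groundSpace_iff H u).mp huG
  have hSu : totalSpin 1 2 *ᵥ u = (M : ℂ) • u := by
    have h := huK
    rw [spinZSector, Module.End.mem_eigenspace_iff, Matrix.toLin'_apply] at h
    exact h
  have hray : (star (c • u) ⬝ᵥ (H - ((M / (C + 1) : ℝ) : ℂ) • totalSpin 1 2) *ᵥ (c • u)).re =
      E - M / (C + 1) * M := by
    have hKcu : (H - ((M / (C + 1) : ℝ) : ℂ) • totalSpin 1 2) *ᵥ (c • u) =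
        ((E - M / (C + 1) * M : ℝ) : ℂ) • (c • u) := by
      rw [sub_mulVec, smul_mulVec, mulVec_smul, mulVec_smul, hHu, hSu]
      funext σ
      simp only [Pi.sub_apply, Pi.smul_apply, smul_eq_mul]
      push_cast
      ring
    rw [hKcu, dotProduct_smul, hc1, smul_eq_mul, mul_one, Complex.ofReal_re]
  have hle := groundEnergy_le_rayleigh_holds hS (c • u) hc1
  rw [hray] at hle
  have hge := hF (M / (C + 1))
  -- `E - C (M/(C+1))² ≤ E - M²/(C+1)` forces `M = 0`
  have hC1 : 0 < C + 1 := by linarith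
  have key : M / (C + 1) * M ≤ C * (M / (C + 1)) ^ 2 := by linarith
  have key' : M ^ 2 * (C + 1) ≤ C * M ^ 2 := by
    have h := mul_le_mul_of_nonneg_right key (le_of_lt (pow_pos hC1 2))
    field_simp at h
    nlinarith [h, sq_nonneg M, hC1]
  have hM2 : M ^ 2 ≤ 0 := by nlinarith [key', sq_nonneg M]
  exact hσ₀ (pow_eq_zero_iff two_ne_zero |>.mp (le_antisymm hM2 (sq_nonneg M)))

/-! ### The theorem on the whole easy-plane side -/

/-- **Every ground state of the easy-plane spin-½ XXZ torus is half filled** (`Δ ≤ 0`, `d ≥ 1`,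
even `L ≥ 4`): the ground space of `xxzHamiltonian 1 (torusGraph d L) (-1) Δ` lies in the sector
`S³_tot = 0`. The XY point `Δ = 0` is `AnisotropyChord.groundSpace_xyTorus_le_spinZSector_zero`
(`xyTorus d L 1 = xxzHamiltonian 1 (torusGraph d L) (-1) 0` by `rfl`), the rest is
`groundSpace_xxzTorus_le_spinZSector_zero_of_neg`. Aizenman–Lieb–Seiringer–Solovej–Yngvason (2004),
App. A; Lieb–Seiringer–Solovej–Yngvason (2005), Ch. 11, p. 115 ("the lowest energy is obtained
uniquely for `N = |Λ|/2`"). [folklore] -/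
theorem groundSpace_xxzTorus_le_spinZSector_zero (hd : 1 ≤ d) (L : ℕ) [NeZero L]
    (hL : Even L) (hL3 : 3 ≤ L) {Δ : ℝ} (hΔ : Δ ≤ 0) :
    (xxzHamiltonian 1 (torusGraph d L) (-1) Δ).groundSpace ≤ spinZSector 1 0 := by
  rcases hΔ.lt_or_eq with hlt | heq
  · exact groundSpace_xxzTorus_le_spinZSector_zero_of_neg hd L hL hL3 hlt
  · rw [heq]
    exact groundSpace_xyTorus_le_spinZSector_zero hd L hL hL3

end Summit.HubbardSuperconductivity.HubbardSuperconductivity.Theorems.LevyLogBootstrap
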